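/-
Copyright (c) 2026 the pub-hodgecm-mathlib formalisation cell (harness21).  Prover seat hodgecm-mathlib-LH4-p01 (g9), 2026-09-02.  LH4 road «M6 ROW 2 ★ DYADIC TWIN»
(LEAD F0P3a-plan T14-66; LH4-plan (g8) WORD #56, brick F4-d′ FILE α1): the skew square root of the type-(2) eigen-discriminant WITHOUT `|2|_w = 1`.
-/
import Literature.NumberTheory.LocalFields.InertPlaceSkewDiscriminantRoot   -- ★ (D2-α) p846675 (F0P2-p06 (g11)): `exists_isUnit_galAdicCompletionMap_sub` (hmove), the CM uniformiser kit; brings ★ `exists_toPlace_eq_of_galAdicCompletionMap_eq`, ★ Q5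
import HarnessLib

/-!
# (D2-α)″ The skew square root of the eigen-discriminant at an inert-unramified place, ANY RESIDUE CHARACTERISTIC: `t² − 4D = y²·ι f` with `σ_w y = −y·σ_w D`,
# `f ∈ L⁺_v`; and on the ODD-ORDER row `f = k₀` a uniformiser, `|y|_w = exp(−N)` — ★ (D2-α) `exists_skew_sqrt_discriminant` without `|2| = 1`

Topic `NumberTheory/LocalFields`; namespace `Literature.NumberTheory.LocalFields`.  THEOREMS ONLY (no definition, no instance, no notation, no named fact, no `sorry`); kernel lane
`--supports stmt-HodgeConjecture-24833`.  Cell `pub/hodgecm-mathlib` (D-0151), crux H413 = `stmt-HodgeConjecture-24833`; LH4 road «M6 ROW 2 ★ DYADIC TWIN» (LEAD T14-66, dealer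
LH4-plan (g8) WORD #56; census `F0/P3c/LH4/LH4-p01/g9/o4/f4d/SIG-F4d-census.v1.LH4p01g9.md` §3).  SUPERSEDES NOTHING — ★ (D2-α) keeps its consumers; the W-ODD dyadic ROW-2 place
head (LH10-p01, re-thread of ★ `DepthZeroKappaTransferTypeTwoRowTwoPlace`) consumes §2 in place of ★ (D2-α)'s call.
HONEST LABEL: HC_CM is proved only modulo the 7 printed citations (2 remaining named inputs: hLiu418 = stmt-HodgeConjecture-24832, h413 = stmt-HodgeConjecture-24833) until rung 0
closes; unconditional local algebra, count-neutral (pays no organ, opens no road; zero label movement until F5 ★ and a desk-priced rider).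

THE MATHEMATICS.  `L` CM, `w ∣ v` inert and unramified, `σ = σ_w`, `ι = toPlace v w`; `t, D ∈ L_w` with `D·σD = 1`, `σt = t·σD` (trace and determinant of a unitary 2×2 block).
★ (D2-α) writes `t² − 4D = y²·ι k₀` with `σy = −y·σD` and `k₀` a uniformiser of `L⁺_v` by taking a SQUARE ROOT of `D` — «`D·σD = 1 ⇒ D ∈ (L_w^×)²`» needs `|2|_w = 1` (at `p = 2`,
`E¹∕(E¹)²` has order 2).  HERE instead: HILBERT 90 MADE EXPLICIT — `c₀ := −σD` has `c₀·σc₀ = 1`, and `y := x − D·σx` satisfies `σy = −σD·y` for EVERY `x`; `y ≠ 0` for `x = 1` or for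
hmove's `a` (★ `exists_isUnit_galAdicCompletionMap_sub`: `σa − a` a unit), since both vanish only if `D = 1` and `σa = a`.  Then `(t² − 4D)∕y²` is `σ`-FIXED (`σ(t² − 4D) =
(t² − 4D)·σD²`, `σ(y²) = y²·σD²`), hence `= ι f` (★ `exists_toPlace_eq_of_galAdicCompletionMap_eq`): §1 `exists_skew_sqrt_discriminant_rational` (no parity, no `|2|`).  If
`ord_w(t² − 4D) = 2N + 1` is ODD then `ord_v f` is odd, and rescaling `y` by a power of the uniformiser `ι ϖ_v` makes `f` a uniformiser `k₀` and `|y|_w = exp(−N)`: §2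
`exists_skew_sqrt_discriminant_uniformiser` = ★ (D2-α)'s conclusion with its `h2` binder GONE (plus `y ≠ 0` in front).  The EVEN-order (wild unit-discriminant) row is the sibling file
`InertPlaceSkewDiscriminantRootWildUnit` (★ W3a + ★ (C4)); no `IsUnit 2`, no `|2| = 1`, no `d(K₂∕L_w)` binder anywhere (T14-66 KILL clause honoured).

## References
* [Rogawski1990] J. D. Rogawski, *Automorphic Representations of Unitary Groups in Three Variables* (1990): §4.9 Lemma 4.9.3 p. 56.
* [SerreLocalFields1979] J.-P. Serre, *Local Fields*, GTM 67 (1979): Ch. X §1 (Hilbert 90); Ch. V §2.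
* [Neukirch1999] J. Neukirch, *Algebraic Number Theory*, Grundlehren 322 (1999): Ch. IV (3.8) (Hilbert 90), Ch. II (5.7)–(5.8).
-/

set_option autoImplicit false

noncomputable section

open NumberField IsDedekindDomain Polynomial
open scoped ValuativeRel
open Literature.NumberTheory.Automorphic Literature.NumberTheory.Automorphic.UnitaryGroup Literature.NumberTheory.NumberFields
open Literature.NumberTheory.GaloisRepresentations

namespace Literature.NumberTheory.LocalFields

section CM

variable (L : Type) [Field L] [NumberField L] [IsCMField L] (v : HeightOneSpectrum (𝓞 ↥(maximalRealSubfield L)))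
  (w : PlacesOver L v) (hw : IsCMField.complexConj L • w.1 = w.1) (hunr : Algebra.IsUnramifiedIn (𝓞 L) v.asIdeal)

/-! ## §1 Hilbert 90 made explicit: a skew square root over an `L⁺_v`-rational class, no parity, no `|2|` -/

include hunr in
/-- **`t² − 4D = y²·ι f` WITH `σ_w y = −y·σ_w D` AND `f ∈ L⁺_v`**, at an inert-unramified place, any residue characteristic: for `D·σD = 1`, `σt = t·σD`
there are `y ∈ L_w^×` and `f ∈ L⁺_v` with `σ_w y = −(y·σ_w D)` and `4D = t·t − y·y·ι f` (`y := x − D·σx` for `x = 1` or hmove's `a`; `(t² − 4D)∕y²` is `σ_w`-fixed;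
`f = 0` is allowed when `t² = 4D`).
[cite: SerreLocalFields1979, Ch. X §1] [cite: Neukirch1999, Ch. IV (3.8)] [cite: Rogawski1990, §4.9 Lemma 4.9.3 p. 56] -/
theorem exists_skew_sqrt_discriminant_rational {t D : w.1.adicCompletion L}
    (hσD : D * galAdicCompletionMap (L := L) (IsCMField.complexConj L) hw D = 1)
    (hσt : galAdicCompletionMap (L := L) (IsCMField.complexConj L) hw t = t * galAdicCompletionMap (L := L) (IsCMField.complexConj L) hw D) :
    ∃ (y : w.1.adicCompletion L) (f : v.adicCompletion ↥(maximalRealSubfield L)),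
      y ≠ 0 ∧ galAdicCompletionMap (L := L) (IsCMField.complexConj L) hw y = -(y * galAdicCompletionMap (L := L) (IsCMField.complexConj L) hw D) ∧
        4 * D = t * t - y * y * toPlace v w f := by
  set σ := galAdicCompletionMap (L := L) (IsCMField.complexConj L) hw with hσdef
  have hc1 : IsCMField.complexConj L ≠ 1 := IsCMField.complexConj_ne_one L
  have hσσ : ∀ x, σ (σ x) = x := galAdicCompletionMap_galAdicCompletionMap_of_smul_eq (IsCMField.complexConj L) w hc1 hw
  have hσD0 : σ D ≠ 0 := fun h0 => by rw [h0, mul_zero] at hσD; exact zero_ne_one hσD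
  -- Hilbert 90 made explicit for the cocycle `c₀ = −σD`
  have key : ∀ x, σ (x - D * σ x) = -((x - D * σ x) * σ D) := fun x => by
    rw [map_sub, map_mul, hσσ]
    linear_combination (-(σ x)) * hσD
  -- a non-zero instance: `x = 1` unless `D = 1`, then hmove's `a`
  obtain ⟨a, -, -, b, hb⟩ := exists_isUnit_galAdicCompletionMap_sub L v w hw hunr
  have hane : σ (a : w.1.adicCompletion L) - a ≠ 0 := fun h0 => by
    have h := hb; rw [← hσdef, h0, mul_zero] at h; exact zero_ne_one h
  have hy : ∃ y : w.1.adicCompletion L, y ≠ 0 ∧ σ y = -(y * σ D) := by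
    by_cases h1 : (1 : w.1.adicCompletion L) - D * σ 1 = 0
    · have hD1 : D = 1 := by rw [map_one, mul_one, sub_eq_zero] at h1; exact h1.symm
      refine ⟨(a : w.1.adicCompletion L) - D * σ a, ?_, key a⟩
      rw [hD1, one_mul]
      intro h0
      exact hane (by linear_combination (-1 : w.1.adicCompletion L) * h0)
    · exact ⟨1 - D * σ 1, h1, key 1⟩
  obtain ⟨y, hy0, hσy⟩ := hy
  have hyy0 : y * y ≠ 0 := mul_ne_zero hy0 hy0
  -- `(t² − 4D) ∕ y²` is `σ`-fixed, hence `L⁺_v`-rational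
  have hσΔ : σ (t ^ 2 - 4 * D) = (t ^ 2 - 4 * D) * (σ D * σ D) := by
    rw [map_sub, map_pow, map_mul, map_ofNat, hσt]
    linear_combination (4 * σ D) * hσD
  have hσyy : σ (y * y) = (y * y) * (σ D * σ D) := by rw [map_mul, hσy]; ring
  have hfix : σ ((t ^ 2 - 4 * D) / (y * y)) = (t ^ 2 - 4 * D) / (y * y) := by
    rw [map_div₀, hσΔ, hσyy, mul_div_mul_right _ _ (mul_ne_zero hσD0 hσD0)]
  obtain ⟨f, hf⟩ := exists_toPlace_eq_of_galAdicCompletionMap_eq (IsCMField.complexConj L) w hc1 hw _ hfix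
  refine ⟨y, f, hy0, hσy, ?_⟩
  have hcancel : y * y * ((t ^ 2 - 4 * D) / (y * y)) = t ^ 2 - 4 * D := mul_div_cancel₀ _ hyy0
  rw [hf, hcancel]
  ring

/-! ## §2 The odd-order row: the rational class is a uniformiser — ★ (D2-α)'s conclusion without `|2| = 1` -/

include hunr in
/-- **`t² − 4D = y² · ι_w k₀` WITH `k₀` A UNIFORMISER OF `L⁺_v`, `σ_w y = −y·σ_w D` AND `|y|_w = exp(−N)`, WITHOUT `|2| = 1`**: for `D·σD = 1`, `σt = t·σD` and
`ord_w(t² − 4D) = 2N + 1` (the TAME row, and the ODD-ORDER WILD row at a dyadic place).  This is ★ (D2-α) `exists_skew_sqrt_discriminant`'s conclusion (four conjuncts, token for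
token) with `y ≠ 0` prepended, under ★'s binders MINUS `h2` — from §1 by rescaling `y` with a power of `ι ϖ_v`. [cite: Rogawski1990, §4.9 Lemma 4.9.3 p. 56]
[cite: SerreLocalFields1979, Ch. X §1; Ch. V §2] [cite: Neukirch1999, Ch. II (5.7)–(5.8)] -/
theorem exists_skew_sqrt_discriminant_uniformiser {t D : w.1.adicCompletion L}
    (hσD : D * galAdicCompletionMap (L := L) (IsCMField.complexConj L) hw D = 1)
    (hσt : galAdicCompletionMap (L := L) (IsCMField.complexConj L) hw t = t * galAdicCompletionMap (L := L) (IsCMField.complexConj L) hw D)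
    {N : ℕ} (hdisc : Valued.v (t ^ 2 - 4 * D) = WithZero.exp (-((2 * N + 1 : ℕ) : ℤ))) :
    ∃ (y : w.1.adicCompletion L) (k₀ : v.adicCompletion ↥(maximalRealSubfield L)),
      y ≠ 0 ∧ Valued.v k₀ = WithZero.exp (-1 : ℤ) ∧ 4 * D = t * t - y * y * toPlace v w k₀ ∧
        galAdicCompletionMap (L := L) (IsCMField.complexConj L) hw y = -(y * galAdicCompletionMap (L := L) (IsCMField.complexConj L) hw D) ∧
        Valued.v y = WithZero.exp (-(N : ℤ)) := by
  set σ := galAdicCompletionMap (L := L) (IsCMField.complexConj L) hw with hσdef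
  set ϖF : v.adicCompletion ↥(maximalRealSubfield L) := (HeckeCharacter.uniformizer ↥(maximalRealSubfield L) v : v.adicCompletion ↥(maximalRealSubfield L))
    with hϖFdef
  set ϖ : w.1.adicCompletion L := toPlace v w ϖF with hϖdef
  have hϖ0 : ϖ ≠ 0 := toPlace_uniformizer_ne_zero L v w hunr
  have hϖF0 : ϖF ≠ 0 := fun h0 => hϖ0 (by rw [hϖdef, h0, map_zero])
  have hσϖ : σ ϖ = ϖ := galAdicCompletionMap_toPlace_self L v w hw _
  have hvϖ : Valued.v ϖ = WithZero.exp (-1 : ℤ) := valued_toPlace_uniformizer L v w hunr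
  have he1 : v.asIdeal.ramificationIdx' w.1.asIdeal = 1 := ramificationIdx'_eq_one_of_isUnramifiedIn L v w hunr
  have hιv : ∀ a : v.adicCompletion ↥(maximalRealSubfield L), Valued.v (toPlace v w a) = Valued.v a :=
    valued_toPlace_of_ramificationIdx'_eq_one L v w he1
  have hvϖF : Valued.v ϖF = WithZero.exp (-1 : ℤ) := by rw [← hιv, ← hϖdef, hvϖ]
  -- §1
  have hΔ0 : t ^ 2 - 4 * D ≠ 0 := fun h0 => by rw [h0, map_zero] at hdisc; exact WithZero.zero_ne_coe hdisc
  obtain ⟨y, f, hy0, hσy, hDf⟩ := exists_skew_sqrt_discriminant_rational L v w hw hunr hσD hσt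
  have hvy0 : Valued.v y ≠ 0 := (Valuation.ne_zero_iff _).2 hy0
  have hΔeq : t ^ 2 - 4 * D = y * y * toPlace v w f := by linear_combination (-1 : w.1.adicCompletion L) * hDf
  have hf0 : f ≠ 0 := fun h0 => hΔ0 (by rw [hΔeq, h0, map_zero, mul_zero])
  have hvf0 : Valued.v f ≠ 0 := (Valuation.ne_zero_iff _).2 hf0
  -- the order bookkeeping: `2·log|y| + log|f| = −(2N+1)`
  have hlog : 2 * WithZero.log (Valued.v y) + WithZero.log (Valued.v f) = -((2 * N + 1 : ℕ) : ℤ) := by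
    have h := hdisc
    rw [hΔeq, map_mul, map_mul, hιv, ← WithZero.exp_log hvy0, ← WithZero.exp_log hvf0, ← WithZero.exp_add, ← WithZero.exp_add, WithZero.exp_inj] at h
    linear_combination h
  -- `s := log|y| + N`, so that `log|f| = −1 − 2s`
  set s : ℤ := WithZero.log (Valued.v y) + N with hsdef
  have hlogf : WithZero.log (Valued.v f) = -1 - 2 * s := by
    rw [hsdef]; push_cast at hlog ⊢; linear_combination hlog
  -- rescale: `y′ := y · ι ϖ_v^{−s}`·?  We want `|y′| = exp(−N)`: `y′ := y · ϖ^{−s}` has `log|y′| = log|y| + s = ... `; take `y′ := y * ϖ ^ (-s)`?  `log|ϖ^{-s}| = s`, so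
  -- `log|y′| = log|y| + s = 2·log|y| + N` — not what we want.  Use `y′ := y * ϖ ^ (s')` with `s' := −(log|y| + N) = −s`... then `log|y′| = log|y| + s = `? careful: `log|ϖ^k| = −k`.
  -- With `k := s`: `log|y·ϖ^s| = log|y| − s = −N` ✓; and `k₀ := f · ϖ_v^{−2s}`: `log|k₀| = log|f| + 2s = −1` ✓; `y′² ι k₀ = y² ι f` ✓.
  refine ⟨y * ϖ ^ s, f * ϖF ^ (-(2 * s)), mul_ne_zero hy0 (zpow_ne_zero _ hϖ0), ?_, ?_, ?_, ?_⟩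
  · -- `|k₀| = exp(−1)`
    rw [map_mul, map_zpow₀, hvϖF, ← WithZero.exp_zsmul, ← WithZero.exp_log hvf0, hlogf, ← WithZero.exp_add]
    congr 1; simp only [smul_eq_mul]; ring
  · -- `4D = t·t − y′·y′·ι k₀`
    have hι : toPlace v w (f * ϖF ^ (-(2 * s))) = toPlace v w f * ϖ ^ (-(2 * s)) := by rw [map_mul, map_zpow₀, ← hϖdef]
    rw [hι]
    have hz : ϖ ^ s * (ϖ ^ s) * ϖ ^ (-(2 * s)) = 1 := by
      rw [← zpow_add₀ hϖ0, ← zpow_add₀ hϖ0, show s + s + -(2 * s) = 0 by ring, zpow_zero]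
    linear_combination hDf + (y * y * toPlace v w f) * hz
  · -- `σ y′ = −(y′·σD)`
    rw [map_mul, map_zpow₀, hσϖ, hσy]; ring
  · -- `|y′| = exp(−N)`
    rw [map_mul, map_zpow₀, hvϖ, ← WithZero.exp_zsmul, ← WithZero.exp_log hvy0, ← WithZero.exp_add]
    congr 1; simp only [smul_eq_mul, hsdef]; ring

end CM

end Literature.NumberTheory.LocalFields

end
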